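/-
Copyright (c) 2026 the pub-hodgecm-mathlib formalisation cell (harness21).  Seat hodgecm-mathlib-F0P3a-p01 (g30): heir LEAD F0P3a-plan (g19) T18-10 «#175-R SCOPE» (b)(d)
(director g36 s1830; desk D-O7∕D-O7b; K2E4-r01 O7-VERDICT 9d20d85d782e07ce; registrar A-plan1 (g34) m14∕m16 pinned letters L1∕L2∕T2) — the PINNED twin (T1) of
★ `Theorems/F0P3Rung0OfLettersNormalised.lean` (the rung-0 closer from the letters, S1′ normalised).  2026-09-03.
-/
import Summits.HodgeConjecture.HodgeConjecture.Theorems.F0P3aGlobalTransferCartanKappaOfStubs      -- ★ p832532 (T6-L3 twin): `globalTransferCartanKappa_pointed_of_stubs`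
import Summits.HodgeConjecture.HodgeConjecture.Theorems.F0P3aGlobalTransferPackageAndOfStubs      -- ★ p832648 (T6-L4 twin): `globalTransferPackageAnd_of_stubs`
import Summits.HodgeConjecture.HodgeConjecture.Theorems.F0P3aSingularEllipticTransferOfStubs       -- ★ p833050 (T6-L5 twin): `singularEllipticTransferCanonical_of_stubs` (P1–P4 ★ p832859∕p832861 inside)
import Summits.HodgeConjecture.HodgeConjecture.Theorems.F0P3aArchTransfersCanonicalOfStubs       -- ★ FILE 4 (T6-L1 twin): `archTransfersExistCanonical_of_stubs`, `archEndoscopicTransferCompatible_of_ray`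
import Summits.HodgeConjecture.HodgeConjecture.Theorems.F0P3Rung0HaarPackageHaar                  -- ★ p830764: `exists_rung0HaarPackage_haar` (the measure block)
import Literature.NumberTheory.Rogawski1990.ArchTransfersSingularOfCanonical                      -- ★ p833110: (S-c) `ArchTransfersSingularOfCanonicalClosed`
import Literature.NumberTheory.Rogawski1990.ArchCentralValueTransferExists                        -- ★ p832777: (S-d) `ArchCentralValueTransferExistsClosed` (∃ν shape)
import Literature.NumberTheory.Rogawski1990.LocalTransferUnitExplicitFactor                       -- ★ p832938: N6 `LocalTransferExplicitClosed`, N7 `UnitFundamentalLemmaExplicitClosed`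
import Literature.NumberTheory.Rogawski1990.TamagawaSingularMembersNormalisedLetterPinned         -- #175-R L2 (registrar A-plan1 (g34)): `TamagawaSingularMembersExistNormalisedClosedPinned` (S1′ normalised, PINNED at (Δ‴_∞, (Δ‴_v)_v))
import Literature.NumberTheory.Rogawski1990.SingularEllipticTransferCanonicalPinned             -- #175-R T2 (registrar): `SingularEllipticTransferCanonicalPinned` (the `hSET` conjunct, `Δ` no longer a binder)
import Literature.NumberTheory.Rogawski1990.TamagawaSingularMembersNormalisedLetter               -- ★ p844968 (F0P3a-p07 g10, ROAD F′ (F-A)): `TamagawaSingularMembersExistNormalisedClosed` (+ ★ p833072 S1′ letter)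
import Literature.NumberTheory.Rogawski1990.ArchExplicitTransferFactorNondegenerate               -- ★ p827632: `isArchNondegenerate_archCanonicalTransferFactor`
import Literature.NumberTheory.QuadraticForms.LandherrHermitianDefinitePlace                      -- ★ p826840's input: a definite complex place (T6-L2's (P))
import Literature.NumberTheory.Rogawski1990.PureTensorCentralValues                              -- ★ `ArchCanonicalSingularMatrix.central_value` (T6-L5's `hSd := hACS.central_value`)
import Literature.NumberTheory.Automorphic.UnitaryGroupCovolWeightStable                          -- ★ `isClosed_centralizer_cmDatum`, `isHaarMeasure_count_quotientSubgroup_inf_centralizer_subgroupOf` (MAIN-b's `hSET` preamble)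
import HarnessLib

/-!
# #175-R · T1 — THE PINNED TWIN of ★ `F0P3Rung0OfLettersNormalised.rung0Data_of_letters_normalised` (LEAD T18-10 (b); registrar A-plan1 (g34) m14∕m16 design of record)

WHAT CHANGED vs ★ `rung0Data_of_letters_normalised` (everything else byte-identical): (i) the S1′ letter hypothesis is the PINNED closed letter
`hS1 : TamagawaSingularMembersExistNormalisedClosedPinned` (#175-R L2) — the framed `∀ Δ` weak-frame letter `TamagawaSingularMembersExistNormalisedClosed` is MISSTATED AS TYPED on the
Δ-side, model-relative (K2E4-r01 O7-VERDICT 9d20d85d782e07ce ∕ U1-FALSIFIER ad7420429788ac50; director s1830; LEAD T18-10 (0)); (ii) the `hSET` conjunct of the conclusion is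
`SingularEllipticTransferCanonicalPinned L H μω νH νG νGi νqi νHi ν` (#175-R T2: print's own pair `(Δ‴_∞, (Δ‴_v)_v) = (archCanonicalTransferFactor L H μω, finExplicitCollection L H μω …)`,
`Δ` NO LONGER A BINDER); (iii) in the proof the `hSET` branch introduces `hanis′ Sbad mH mG hCTM m′ m mHi t′ t tH hACS` (no `Δ`) and feeds ★ T6-L5
`singularEllipticTransferCanonical_of_stubs` with `hS1 L H μω hμu hμω νH νG νGi νqi νHi ν hK hanis′ Sbad mH mG m′ m mHi t′ t tH hherm hCTM hACS` (★ :347's call with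
`Tinf ↦ μω hμu hμω` and `Δ` gone — T6-L5 takes `hS1` fully applied, so no T6-L5 twin is needed).  `hAT₄`, `hGTQ`, `hPH` and the measure block: unchanged.
Consumers: T4 (`Rung0WitnessSPinned.hSET`, KitRung0 `rung0_of_letters_pinned`, KitD) and AGG ED. 44 (registrar pen).  The ORIGINAL module docstring follows unchanged.
-/

/-!
# F0 ∕ P3 — THE RUNG-0 DATA FROM THE NINE LETTERS, S1′ READ IN ITS NORMALISED FORM (ROAD F′ (F-A) consumer twin of ★ `F0P3Rung0OfLetters`; theorems only, no Lines import)
# (cell `hodgecm-mathlib`, crux H413 = `stmt-HodgeConjecture-24833`; A-p06 (g29) for ROAD F′ owner F0P3a-p07 (g10) SPEC F′-4 (n3) «consumer twin `rung0Data_of_letters′` with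
# `hS1 : …ExistNormalisedClosed`», LEAD F0P3a-plan (g10) T9-45 (3); the original is F0P3a-p01 (g9)'s)

THIS FILE = ★ `Theorems/F0P3Rung0OfLetters.lean` (tree 3e024e4de099436f) TOKEN FOR TOKEN, with exactly three changes: (1) the S1′ hypothesis is the WEAKER normalised letter
★ `TamagawaSingularMembersExistNormalisedClosed` (p844968: S1′'s frame, then `(∀ v, νG v (K_v) = 1) →`, then `TamagawaSingularMembersExist …` by name) instead of
★ `TamagawaSingularMembersExistClosed`; (2) at the single consumption site (`hSET`) the normalisation `hK` — which the measure block ★ `exists_rung0HaarPackage_haar` hands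
out and the conclusion re-exports as `_hK` — is passed to the letter; (3) namespace∕name `F0P3Rung0OfLettersNormalised.rung0Data_of_letters_normalised`.  Conclusion
UNCHANGED.  Purpose: when ROAD F′ folds «S1finTF ⟸ COVOL» the closer's S1-row is the NORMALISED letter (F′-3: the ★ O10-s covolume tower is built from level-normalised
local Haar measures, so only the normalised S1′ is reachable from `…FinTFCovolClosed`), and this twin is the consumer that reads it.

WHAT THIS FILE IS.  ONE sorry-free theorem `rung0Data_of_letters`: at every letters' frame (`Tᴴ ι(H) T = J`, `H` definite off `ι`, `[L⁺:ℚ] ≥ 2`, `μω` unitary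
with `μω|_{𝕀_{L⁺}} = ω_{L∕L⁺}`), the NINE booked letters of the T6 pay-down lines — N8 ★ `ArchInnerTransferCompatible` (#94), N9″ ★
`ArchEndoscopicTransferCompatible … (archExplicitTransferFactor …)` (#95), (S-c) ★ `ArchTransfersSingularOfCanonicalClosed`, (S-d) ★ `ArchCentralValueTransferExistsClosed`,
N6 ★ `LocalTransferExplicitClosed` (#102), N7 ★ `UnitFundamentalLemmaExplicitClosed` (#103), S1′ ★ `TamagawaSingularMembersExistClosed` (#88), and — kept as a
HYPOTHESIS ON THE RIDER — «`Q Δ‴ mH mG` for every canonical pair» (the closer feeds `Q := Q_K9`, i.e. Q-CM ★ `CMCharIdentityPackage` [Prop. 13.1.4] ∧ its K9-override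
cluster) — IMPLY the ∃-CONTENT of the closer's `Rung0Witness` (`Cruxes/H413/Lines/F0_U3LettersRung1.lean` ED. 8 :971–1125) with `Q` generic: Haar data
`(ν, νH, νG, νGi, νqi, νHi, μZ)` + their 15 normalisation facts, and the three T1 antecedents `hAT₄ : ArchTransfersExistCanonicalSingular …`,
`hSET : SingularEllipticTransferCanonical …`, `hGTQ : GlobalTransferWithStabilisationPackageAnd … Q` at `Tinf := archCanonicalTransferFactor L H μω` (print's `Δ‴_∞`,
FORCED by the #72 side), plus PH `IsProductHaar …`.  The field texts below are the closer's, token for token up to the T1-Kit abbreviations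
(`GpAdelic`, `GpLocal`, `HLocal`, `GpInf`, `GInf`, `HInf` — reducible `abbrev`s of a Lines module, here EXPANDED to their ★ carriers) and `(Q_K9 …) ↦ Q`; they were
GENERATED from the tree by script (fields parsed, no hand-typed tokens inside).  The closer's `Rung0Witness`∕`Q_K9`∕`OverrideWitness`, the sign `c` and the archimedean
classes `jInf`∕`dsInf` with their clauses (R3∕R4) stay closer-side.
PROOF = the kernel junction of record (F0P3a-p01 (g9) probe Stage C, TRIO) over ★ Theorems twins only: the measure block from ★ `exists_rung0HaarPackage_haar`
EXCEPT `νqi`, which is TAKEN FROM the (S-d) letter's `∃ν` (the print-compatible ray `dg = c|Ω|`, §1.7 p. 6 — ★ `TransferFactsCanonicalSingular` ED. 3 erratum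
R1-162-O2: (S-d) holds on one ray of `ν` only); `hAT₄` := (S-c) over T6-L1's composition ★ `archTransfersExistCanonical_of_stubs` ((M) ★ p827798, N2∞ ★
`isArchNondegenerate_archCanonicalTransferFactor`, N8, N9″ moved to `Δ‴_∞ = c(H)·Δ″_∞` by ★ `archEndoscopicTransferCompatible_of_ray`), the compact place (P) by ★
`hermitianMatrix_exists_definite_infinitePlace_of_anisotropic`, and (S-d) at that `νqi`; `hSET` := T6-L5's ★ `singularEllipticTransferCanonical_of_stubs` from S1′
(P1–P4 ★ inside); `hGTQ Q` := T6-L4's ★ `globalTransferPackageAnd_of_stubs` over T6-L3's ★ `globalTransferCartanKappa_pointed_of_stubs` (N6, N7; N2f∕N3∕N4∕N5 ★).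
HONEST LABEL: HC_CM is proved only modulo the printed citations until rung 0 closes; this file proves an implication from nine booked letters and closes no stub —
the closer's junction `stub_rung0 := …` over nine registered `stub_*` of these ★ types is F0P3-plan's edition (ED. ≥ 10), books count-neutral (every letter is
already a row).  Theorems only; no `def`, no instance, no notation; `--kind proof --supports stmt-HodgeConjecture-24833 --as helper`.

References: [Rogawski1990] §4.9 Prop. 4.9.1 p. 55, §4.3 (4.3.1)–(4.3.3) pp. 43–44, §14.2 (14.2.1) pp. 232–233, §14.3 pp. 233–234, §14.5 L. 14.5.2 pp. 238–239,
§14.6 Thm. 14.6.1 p. 241, p. 242, §13.1 p. 199, §1.7 p. 6; [LanglandsShelstad1987] §1.3–1.4, §6.4; [Kottwitz1988] Thm. 1; [Shelstad1979] Thm. 4.1.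
-/

set_option autoImplicit false
set_option linter.dupNamespace false

noncomputable section

open MeasureTheory Measure NumberField NumberField.InfinitePlace IsDedekindDomain
open Literature.MeasureTheory.Group
open Literature.NumberTheory.Rogawski1990 Literature.NumberTheory.Automorphic Literature.NumberTheory.GaloisRepresentations
open Literature.AlgebraicGeometry.ShimuraVarieties (unitaryGroup hermForm)
open Summit.HodgeConjecture.HodgeConjecture.Cruxes.H413
open Summit.HodgeConjecture.HodgeConjecture.Cruxes.H413.F0P3LettersTraceFactorisation (IsProductHaar)
open scoped Matrix MatrixGroups ComplexOrder

namespace Summit.HodgeConjecture.HodgeConjecture.Cruxes.H413.F0P3Rung0OfLettersNormalisedPinned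

set_option maxHeartbeats 400000 in
/-- **THE RUNG-0 DATA FROM THE LETTERS, S1′ NORMALISED.**  At a letters' frame, the nine booked letters (N8, N9″, (S-c), (S-d), N6, N7 by ★ name; the rider `Q` as the frame
hypothesis of the `hGTQ` clause; S1′ in its NORMALISED form ★ `TamagawaSingularMembersExistNormalisedClosed` by name, fed the block's `hK`) give the ∃-content of the closer's `Rung0Witness` with `Q` generic: the Haar measure block with its normalisations,
`hAT₄`, `hSET`, `hGTQ Q` at `Tinf := archCanonicalTransferFactor L H μω`, and PH — `νqi` chosen on the print-compatible ray handed by (S-d).  Sorry-free; the letters are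
hypotheses. [cite: Rogawski1990, §4.9 Prop. 4.9.1 p. 55; §14.2–14.3 pp. 232–234; §14.5 Lemma 14.5.2 pp. 238–239; §14.6 p. 242; §13.1 p. 199; §1.7 p. 6]
[cite: LanglandsShelstad1987, §6.4] [cite: Kottwitz1988, Thm. 1] -/
theorem rung0Data_of_letters_normalisedPinned (L : Type) [Field L] [NumberField L] [IsCMField L] (ι : L →+* ℂ) (H : Matrix (Fin 3) (Fin 3) L) (T : GL (Fin 3) ℂ)
    (hT : (T : Matrix (Fin 3) (Fin 3) ℂ)ᴴ * H.map ι * (T : Matrix (Fin 3) (Fin 3) ℂ) = Literature.Geometry.ComplexHyperbolic.BallModel.J)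
    (hdef : ∀ τ' : L →+* ℂ, InfinitePlace.mk τ' ≠ InfinitePlace.mk ι → (H.map τ').PosDef)
    (h2 : 2 ≤ Module.finrank ℚ ↥(maximalRealSubfield L))
    (μω : HeckeCharacter L) (hμu : μω.IsUnitary)
    (hμω : ∀ x : Literature.NumberTheory.GaloisRepresentations.ideleGroup ↥(maximalRealSubfield L),
      μω (AdeleRing.ideleBaseChange (↥(maximalRealSubfield L)) L x) = quadraticHeckeCharCM L x)
    -- N8 (#94) [Rogawski1990 §14.2 (14.2.1); Shelstad1979 Thm. 4.1]: for all Haar measures on `G′_∞`, `G_∞` (Borel σ-algebras)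
    (h8 :
      letI : MeasurableSpace ↥(UnitaryGroup.arch (↥(maximalRealSubfield L)) L (IsCMField.complexConj L) 3 H) := borel _
      haveI : BorelSpace ↥(UnitaryGroup.arch (↥(maximalRealSubfield L)) L (IsCMField.complexConj L) 3 H) := ⟨rfl⟩
      letI : MeasurableSpace ↥(UnitaryGroup.arch (↥(maximalRealSubfield L)) L (IsCMField.complexConj L) 3 (Matrix.of fun i j : Fin 3 => if i.val + j.val + 1 = 3 then (1 : L) else 0)) := borel _
      haveI : BorelSpace ↥(UnitaryGroup.arch (↥(maximalRealSubfield L)) L (IsCMField.complexConj L) 3 (Matrix.of fun i j : Fin 3 => if i.val + j.val + 1 = 3 then (1 : L) else 0)) := ⟨rfl⟩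
      letI : MeasurableSpace (↥(UnitaryGroup.arch (↥(maximalRealSubfield L)) L (IsCMField.complexConj L) 2 (Matrix.of fun i j : Fin 2 => if i.val + j.val + 1 = 2 then (1 : L) else 0)) × ↥(UnitaryGroup.arch (↥(maximalRealSubfield L)) L (IsCMField.complexConj L) 1 (Matrix.of fun i j : Fin 1 => if i.val + j.val + 1 = 1 then (1 : L) else 0))) := borel _
      haveI : BorelSpace (↥(UnitaryGroup.arch (↥(maximalRealSubfield L)) L (IsCMField.complexConj L) 2 (Matrix.of fun i j : Fin 2 => if i.val + j.val + 1 = 2 then (1 : L) else 0)) × ↥(UnitaryGroup.arch (↥(maximalRealSubfield L)) L (IsCMField.complexConj L) 1 (Matrix.of fun i j : Fin 1 => if i.val + j.val + 1 = 1 then (1 : L) else 0))) := ⟨rfl⟩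
      ∀ (ν' : Measure ↥(UnitaryGroup.arch (↥(maximalRealSubfield L)) L (IsCMField.complexConj L) 3 H)) (ν : Measure ↥(UnitaryGroup.arch (↥(maximalRealSubfield L)) L (IsCMField.complexConj L) 3 (Matrix.of fun i j : Fin 3 => if i.val + j.val + 1 = 3 then (1 : L) else 0)))
        [ν'.IsHaarMeasure] [ν'.IsMulRightInvariant] [ν.IsHaarMeasure] [ν.IsMulRightInvariant],
        ArchInnerTransferCompatible L H ν' ν)
    -- N9″ (#95) at print's `Δ″_∞` [§14.3; §4.9 Prop. 4.9.1 (a); §14.6 p. 242]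
    (h9 :
      letI : MeasurableSpace ↥(UnitaryGroup.arch (↥(maximalRealSubfield L)) L (IsCMField.complexConj L) 3 H) := borel _
      haveI : BorelSpace ↥(UnitaryGroup.arch (↥(maximalRealSubfield L)) L (IsCMField.complexConj L) 3 H) := ⟨rfl⟩
      letI : MeasurableSpace ↥(UnitaryGroup.arch (↥(maximalRealSubfield L)) L (IsCMField.complexConj L) 3 (Matrix.of fun i j : Fin 3 => if i.val + j.val + 1 = 3 then (1 : L) else 0)) := borel _
      haveI : BorelSpace ↥(UnitaryGroup.arch (↥(maximalRealSubfield L)) L (IsCMField.complexConj L) 3 (Matrix.of fun i j : Fin 3 => if i.val + j.val + 1 = 3 then (1 : L) else 0)) := ⟨rfl⟩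
      letI : MeasurableSpace (↥(UnitaryGroup.arch (↥(maximalRealSubfield L)) L (IsCMField.complexConj L) 2 (Matrix.of fun i j : Fin 2 => if i.val + j.val + 1 = 2 then (1 : L) else 0)) × ↥(UnitaryGroup.arch (↥(maximalRealSubfield L)) L (IsCMField.complexConj L) 1 (Matrix.of fun i j : Fin 1 => if i.val + j.val + 1 = 1 then (1 : L) else 0))) := borel _
      haveI : BorelSpace (↥(UnitaryGroup.arch (↥(maximalRealSubfield L)) L (IsCMField.complexConj L) 2 (Matrix.of fun i j : Fin 2 => if i.val + j.val + 1 = 2 then (1 : L) else 0)) × ↥(UnitaryGroup.arch (↥(maximalRealSubfield L)) L (IsCMField.complexConj L) 1 (Matrix.of fun i j : Fin 1 => if i.val + j.val + 1 = 1 then (1 : L) else 0))) := ⟨rfl⟩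
      ∀ (ν' : Measure ↥(UnitaryGroup.arch (↥(maximalRealSubfield L)) L (IsCMField.complexConj L) 3 H)) (ν : Measure ↥(UnitaryGroup.arch (↥(maximalRealSubfield L)) L (IsCMField.complexConj L) 3 (Matrix.of fun i j : Fin 3 => if i.val + j.val + 1 = 3 then (1 : L) else 0))) (νH : Measure (↥(UnitaryGroup.arch (↥(maximalRealSubfield L)) L (IsCMField.complexConj L) 2 (Matrix.of fun i j : Fin 2 => if i.val + j.val + 1 = 2 then (1 : L) else 0)) × ↥(UnitaryGroup.arch (↥(maximalRealSubfield L)) L (IsCMField.complexConj L) 1 (Matrix.of fun i j : Fin 1 => if i.val + j.val + 1 = 1 then (1 : L) else 0))))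
        [ν'.IsHaarMeasure] [ν'.IsMulRightInvariant] [ν.IsHaarMeasure] [ν.IsMulRightInvariant] [νH.IsHaarMeasure] [νH.IsMulRightInvariant],
        ArchEndoscopicTransferCompatible L H
          (archExplicitTransferFactor L H μω (archExplicitDelta_conj_left L H μω) (archExplicitDelta_conj_right L H μω)) ν' ν νH)
    -- (S-c) [Lemma 14.5.2 (c)] and (S-d) [§14.5 p. 239; §1.7 p. 6] BY ★ NAME
    (hSc : ArchTransfersSingularOfCanonicalClosed) (hSd : ArchCentralValueTransferExistsClosed)
    -- N6 (#102) [Prop. 4.9.1 (a)], N7 (#103) [Prop. 4.9.1 (b)] BY ★ NAME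
    (h6 : LocalTransferExplicitClosed) (h7 : UnitFundamentalLemmaExplicitClosed)
    -- S1′ NORMALISED (ROAD F′ (F-A) ★ p844968: the S1′ letter UNDER `hK : ∀ v, νG v (K_v) = 1`) [L. 14.5.2 (b); Prop. 8.2.1; Kottwitz1988] BY ★ NAME
    (hS1 : TamagawaSingularMembersExistNormalisedClosedPinned) :
    ∃ (ν : @Measure ((UnitaryGroup.cmDatum L 3 H).Adelic) (borel _)),
    ∃ (νH : ∀ v : HeightOneSpectrum (𝓞 ↥(maximalRealSubfield L)), @Measure (((UnitaryGroup.cmDatum L 2 (Matrix.of fun i j : Fin 2 => if i.val + j.val + 1 = 2 then (1 : L) else 0)).Local v × (UnitaryGroup.cmDatum L 1 (Matrix.of fun i j : Fin 1 => if i.val + j.val + 1 = 1 then (1 : L) else 0)).Local v)) (borel _)),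
    ∃ (νG : ∀ v : HeightOneSpectrum (𝓞 ↥(maximalRealSubfield L)), @Measure ((UnitaryGroup.cmDatum L 3 H).Local v) (borel _)),
    ∃ (νGi : @Measure (↥(UnitaryGroup.arch (↥(maximalRealSubfield L)) L (IsCMField.complexConj L) 3 H)) (borel _)),
    ∃ (νqi : @Measure (↥(UnitaryGroup.arch (↥(maximalRealSubfield L)) L (IsCMField.complexConj L) 3 (Matrix.of fun i j : Fin 3 => if i.val + j.val + 1 = 3 then (1 : L) else 0))) (borel _)),
    ∃ (νHi : @Measure ((↥(UnitaryGroup.arch (↥(maximalRealSubfield L)) L (IsCMField.complexConj L) 2 (Matrix.of fun i j : Fin 2 => if i.val + j.val + 1 = 2 then (1 : L) else 0)) × ↥(UnitaryGroup.arch (↥(maximalRealSubfield L)) L (IsCMField.complexConj L) 1 (Matrix.of fun i j : Fin 1 => if i.val + j.val + 1 = 1 then (1 : L) else 0)))) (borel _)),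
    ∃ (μZ : ∀ v : HeightOneSpectrum (𝓞 ↥(maximalRealSubfield L)), @Measure (Gqs L v ⧸ Subgroup.center (Gqs L v)) (borel _)),
    ∃ (isHaar_ν : letI : MeasurableSpace ((UnitaryGroup.cmDatum L 3 H).Adelic) := borel _; ν.IsHaarMeasure),
    ∃ (isInvInv_ν : letI : MeasurableSpace ((UnitaryGroup.cmDatum L 3 H).Adelic) := borel _; ν.IsInvInvariant),
    ∃ (isHaar_νH : ∀ v : HeightOneSpectrum (𝓞 ↥(maximalRealSubfield L)), letI : MeasurableSpace (((UnitaryGroup.cmDatum L 2 (Matrix.of fun i j : Fin 2 => if i.val + j.val + 1 = 2 then (1 : L) else 0)).Local v × (UnitaryGroup.cmDatum L 1 (Matrix.of fun i j : Fin 1 => if i.val + j.val + 1 = 1 then (1 : L) else 0)).Local v)) := borel _; (νH v).IsHaarMeasure),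
    ∃ (isRightInv_νH : ∀ v : HeightOneSpectrum (𝓞 ↥(maximalRealSubfield L)), letI : MeasurableSpace (((UnitaryGroup.cmDatum L 2 (Matrix.of fun i j : Fin 2 => if i.val + j.val + 1 = 2 then (1 : L) else 0)).Local v × (UnitaryGroup.cmDatum L 1 (Matrix.of fun i j : Fin 1 => if i.val + j.val + 1 = 1 then (1 : L) else 0)).Local v)) := borel _; (νH v).IsMulRightInvariant),
    ∃ (isHaar_νG : ∀ v : HeightOneSpectrum (𝓞 ↥(maximalRealSubfield L)), letI : MeasurableSpace ((UnitaryGroup.cmDatum L 3 H).Local v) := borel _; (νG v).IsHaarMeasure),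
    ∃ (isRightInv_νG : ∀ v : HeightOneSpectrum (𝓞 ↥(maximalRealSubfield L)), letI : MeasurableSpace ((UnitaryGroup.cmDatum L 3 H).Local v) := borel _; (νG v).IsMulRightInvariant),
    ∃ (_hK : ∀ v : HeightOneSpectrum (𝓞 ↥(maximalRealSubfield L)), νG v (UnitaryGroup.cmLocalIntegralLevel L 3 H v : Set ((UnitaryGroup.cmDatum L 3 H).Local v)) = 1),
    ∃ (_hKH : ∀ v : HeightOneSpectrum (𝓞 ↥(maximalRealSubfield L)),
    νH v (((UnitaryGroup.cmLocalIntegralLevel L 2 (Matrix.of fun i j : Fin 2 => if i.val + j.val + 1 = 2 then (1 : L) else 0) v).prod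
        (UnitaryGroup.cmLocalIntegralLevel L 1 (Matrix.of fun i j : Fin 1 => if i.val + j.val + 1 = 1 then (1 : L) else 0) v) :
          Subgroup (((UnitaryGroup.cmDatum L 2 (Matrix.of fun i j : Fin 2 => if i.val + j.val + 1 = 2 then (1 : L) else 0)).Local v × (UnitaryGroup.cmDatum L 1 (Matrix.of fun i j : Fin 1 => if i.val + j.val + 1 = 1 then (1 : L) else 0)).Local v))) : Set (((UnitaryGroup.cmDatum L 2 (Matrix.of fun i j : Fin 2 => if i.val + j.val + 1 = 2 then (1 : L) else 0)).Local v × (UnitaryGroup.cmDatum L 1 (Matrix.of fun i j : Fin 1 => if i.val + j.val + 1 = 1 then (1 : L) else 0)).Local v))) = 1),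
    ∃ (finCpt_νGi : letI : MeasurableSpace (↥(UnitaryGroup.arch (↥(maximalRealSubfield L)) L (IsCMField.complexConj L) 3 H)) := borel _; IsFiniteMeasureOnCompacts νGi),
    ∃ (rightInv_νGi : letI : MeasurableSpace (↥(UnitaryGroup.arch (↥(maximalRealSubfield L)) L (IsCMField.complexConj L) 3 H)) := borel _; νGi.IsMulRightInvariant),
    ∃ (finCpt_νqi : letI : MeasurableSpace (↥(UnitaryGroup.arch (↥(maximalRealSubfield L)) L (IsCMField.complexConj L) 3 (Matrix.of fun i j : Fin 3 => if i.val + j.val + 1 = 3 then (1 : L) else 0))) := borel _; IsFiniteMeasureOnCompacts νqi),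
    ∃ (rightInv_νqi : letI : MeasurableSpace (↥(UnitaryGroup.arch (↥(maximalRealSubfield L)) L (IsCMField.complexConj L) 3 (Matrix.of fun i j : Fin 3 => if i.val + j.val + 1 = 3 then (1 : L) else 0))) := borel _; νqi.IsMulRightInvariant),
    ∃ (finCpt_νHi : letI : MeasurableSpace ((↥(UnitaryGroup.arch (↥(maximalRealSubfield L)) L (IsCMField.complexConj L) 2 (Matrix.of fun i j : Fin 2 => if i.val + j.val + 1 = 2 then (1 : L) else 0)) × ↥(UnitaryGroup.arch (↥(maximalRealSubfield L)) L (IsCMField.complexConj L) 1 (Matrix.of fun i j : Fin 1 => if i.val + j.val + 1 = 1 then (1 : L) else 0)))) := borel _; IsFiniteMeasureOnCompacts νHi),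
    ∃ (rightInv_νHi : letI : MeasurableSpace ((↥(UnitaryGroup.arch (↥(maximalRealSubfield L)) L (IsCMField.complexConj L) 2 (Matrix.of fun i j : Fin 2 => if i.val + j.val + 1 = 2 then (1 : L) else 0)) × ↥(UnitaryGroup.arch (↥(maximalRealSubfield L)) L (IsCMField.complexConj L) 1 (Matrix.of fun i j : Fin 1 => if i.val + j.val + 1 = 1 then (1 : L) else 0)))) := borel _; νHi.IsMulRightInvariant),
    ∃ (_isHaar_μZ : ∀ v : HeightOneSpectrum (𝓞 ↥(maximalRealSubfield L)), letI : MeasurableSpace (Gqs L v ⧸ Subgroup.center (Gqs L v)) := borel _; (μZ v).IsHaarMeasure),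
    -- `hAT₄` of `Rung0Witness` at `Tinf := Δ‴_∞`
    (letI : MeasurableSpace (↥(UnitaryGroup.arch (↥(maximalRealSubfield L)) L (IsCMField.complexConj L) 3 H)) := borel _
    haveI : BorelSpace (↥(UnitaryGroup.arch (↥(maximalRealSubfield L)) L (IsCMField.complexConj L) 3 H)) := ⟨rfl⟩
    letI : MeasurableSpace (↥(UnitaryGroup.arch (↥(maximalRealSubfield L)) L (IsCMField.complexConj L) 3 (Matrix.of fun i j : Fin 3 => if i.val + j.val + 1 = 3 then (1 : L) else 0))) := borel _
    haveI : BorelSpace (↥(UnitaryGroup.arch (↥(maximalRealSubfield L)) L (IsCMField.complexConj L) 3 (Matrix.of fun i j : Fin 3 => if i.val + j.val + 1 = 3 then (1 : L) else 0))) := ⟨rfl⟩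
    letI : MeasurableSpace ((↥(UnitaryGroup.arch (↥(maximalRealSubfield L)) L (IsCMField.complexConj L) 2 (Matrix.of fun i j : Fin 2 => if i.val + j.val + 1 = 2 then (1 : L) else 0)) × ↥(UnitaryGroup.arch (↥(maximalRealSubfield L)) L (IsCMField.complexConj L) 1 (Matrix.of fun i j : Fin 1 => if i.val + j.val + 1 = 1 then (1 : L) else 0)))) := borel _
    haveI : BorelSpace ((↥(UnitaryGroup.arch (↥(maximalRealSubfield L)) L (IsCMField.complexConj L) 2 (Matrix.of fun i j : Fin 2 => if i.val + j.val + 1 = 2 then (1 : L) else 0)) × ↥(UnitaryGroup.arch (↥(maximalRealSubfield L)) L (IsCMField.complexConj L) 1 (Matrix.of fun i j : Fin 1 => if i.val + j.val + 1 = 1 then (1 : L) else 0)))) := ⟨rfl⟩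
    haveI : IsFiniteMeasureOnCompacts νGi := finCpt_νGi
    haveI : νGi.IsMulRightInvariant := rightInv_νGi
    haveI : IsFiniteMeasureOnCompacts νqi := finCpt_νqi
    haveI : νqi.IsMulRightInvariant := rightInv_νqi
    haveI : IsFiniteMeasureOnCompacts νHi := finCpt_νHi
    haveI : νHi.IsMulRightInvariant := rightInv_νHi
    ArchTransfersExistCanonicalSingular L H (Literature.NumberTheory.Rogawski1990.archCanonicalTransferFactor L H μω) νGi νqi νHi) ∧
    -- `hSET` of `Rung0Witness` at `Tinf := Δ‴_∞`
    (letI : MeasurableSpace ((UnitaryGroup.cmDatum L 3 H).Adelic) := borel _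
    haveI : BorelSpace ((UnitaryGroup.cmDatum L 3 H).Adelic) := ⟨rfl⟩
    haveI : ν.IsHaarMeasure := isHaar_ν
    haveI : ν.IsInvInvariant := isInvInv_ν
    letI : ∀ v : HeightOneSpectrum (𝓞 ↥(maximalRealSubfield L)), MeasurableSpace (((UnitaryGroup.cmDatum L 2 (Matrix.of fun i j : Fin 2 => if i.val + j.val + 1 = 2 then (1 : L) else 0)).Local v × (UnitaryGroup.cmDatum L 1 (Matrix.of fun i j : Fin 1 => if i.val + j.val + 1 = 1 then (1 : L) else 0)).Local v)) := fun _ => borel _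
    haveI : ∀ v : HeightOneSpectrum (𝓞 ↥(maximalRealSubfield L)), BorelSpace (((UnitaryGroup.cmDatum L 2 (Matrix.of fun i j : Fin 2 => if i.val + j.val + 1 = 2 then (1 : L) else 0)).Local v × (UnitaryGroup.cmDatum L 1 (Matrix.of fun i j : Fin 1 => if i.val + j.val + 1 = 1 then (1 : L) else 0)).Local v)) := fun _ => ⟨rfl⟩
    letI : ∀ v : HeightOneSpectrum (𝓞 ↥(maximalRealSubfield L)), MeasurableSpace ((UnitaryGroup.cmDatum L 3 H).Local v) := fun _ => borel _
    haveI : ∀ v : HeightOneSpectrum (𝓞 ↥(maximalRealSubfield L)), BorelSpace ((UnitaryGroup.cmDatum L 3 H).Local v) := fun _ => ⟨rfl⟩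
    letI : MeasurableSpace (↥(UnitaryGroup.arch (↥(maximalRealSubfield L)) L (IsCMField.complexConj L) 3 H)) := borel _
    haveI : BorelSpace (↥(UnitaryGroup.arch (↥(maximalRealSubfield L)) L (IsCMField.complexConj L) 3 H)) := ⟨rfl⟩
    letI : MeasurableSpace (↥(UnitaryGroup.arch (↥(maximalRealSubfield L)) L (IsCMField.complexConj L) 3 (Matrix.of fun i j : Fin 3 => if i.val + j.val + 1 = 3 then (1 : L) else 0))) := borel _
    haveI : BorelSpace (↥(UnitaryGroup.arch (↥(maximalRealSubfield L)) L (IsCMField.complexConj L) 3 (Matrix.of fun i j : Fin 3 => if i.val + j.val + 1 = 3 then (1 : L) else 0))) := ⟨rfl⟩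
    letI : MeasurableSpace ((↥(UnitaryGroup.arch (↥(maximalRealSubfield L)) L (IsCMField.complexConj L) 2 (Matrix.of fun i j : Fin 2 => if i.val + j.val + 1 = 2 then (1 : L) else 0)) × ↥(UnitaryGroup.arch (↥(maximalRealSubfield L)) L (IsCMField.complexConj L) 1 (Matrix.of fun i j : Fin 1 => if i.val + j.val + 1 = 1 then (1 : L) else 0)))) := borel _
    haveI : BorelSpace ((↥(UnitaryGroup.arch (↥(maximalRealSubfield L)) L (IsCMField.complexConj L) 2 (Matrix.of fun i j : Fin 2 => if i.val + j.val + 1 = 2 then (1 : L) else 0)) × ↥(UnitaryGroup.arch (↥(maximalRealSubfield L)) L (IsCMField.complexConj L) 1 (Matrix.of fun i j : Fin 1 => if i.val + j.val + 1 = 1 then (1 : L) else 0)))) := ⟨rfl⟩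
    haveI : ∀ v : HeightOneSpectrum (𝓞 ↥(maximalRealSubfield L)), IsFiniteMeasureOnCompacts (νH v) := fun v => (isHaar_νH v).toIsFiniteMeasureOnCompacts
    haveI : ∀ v : HeightOneSpectrum (𝓞 ↥(maximalRealSubfield L)), (νH v).IsMulRightInvariant := isRightInv_νH
    haveI : ∀ v : HeightOneSpectrum (𝓞 ↥(maximalRealSubfield L)), (νG v).IsHaarMeasure := isHaar_νG
    haveI : ∀ v : HeightOneSpectrum (𝓞 ↥(maximalRealSubfield L)), (νG v).IsMulRightInvariant := isRightInv_νG
    haveI : IsFiniteMeasureOnCompacts νGi := finCpt_νGi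
    haveI : νGi.IsMulRightInvariant := rightInv_νGi
    haveI : IsFiniteMeasureOnCompacts νqi := finCpt_νqi
    haveI : νqi.IsMulRightInvariant := rightInv_νqi
    haveI : IsFiniteMeasureOnCompacts νHi := finCpt_νHi
    haveI : νHi.IsMulRightInvariant := rightInv_νHi
    letI : ∀ (v : HeightOneSpectrum (𝓞 ↥(maximalRealSubfield L))) (γ : (UnitaryGroup.cmDatum L 3 H).Local v),
      MeasurableSpace ((UnitaryGroup.cmDatum L 3 H).Local v ⧸
        Subgroup.centralizer ({γ} : Set ((UnitaryGroup.cmDatum L 3 H).Local v))) := fun _ _ => borel _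
    haveI : ∀ (v : HeightOneSpectrum (𝓞 ↥(maximalRealSubfield L))) (γ : (UnitaryGroup.cmDatum L 3 H).Local v),
      BorelSpace ((UnitaryGroup.cmDatum L 3 H).Local v ⧸
        Subgroup.centralizer ({γ} : Set ((UnitaryGroup.cmDatum L 3 H).Local v))) := fun _ _ => ⟨rfl⟩
    letI : ∀ g : (UnitaryGroup.cmDatum L 3 H).Adelic, MeasurableSpace ((UnitaryGroup.cmDatum L 3 H).Adelic ⧸ Subgroup.centralizer ({g} : Set ((UnitaryGroup.cmDatum L 3 H).Adelic))) := fun _ => borel _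
    haveI : ∀ g : (UnitaryGroup.cmDatum L 3 H).Adelic, BorelSpace ((UnitaryGroup.cmDatum L 3 H).Adelic ⧸ Subgroup.centralizer ({g} : Set ((UnitaryGroup.cmDatum L 3 H).Adelic))) := fun _ => ⟨rfl⟩
    letI : ∀ γ : ↥(UnitaryGroup.arch (↥(maximalRealSubfield L)) L (IsCMField.complexConj L) 3 H), MeasurableSpace (↥(UnitaryGroup.arch (↥(maximalRealSubfield L)) L (IsCMField.complexConj L) 3 H) ⧸ Subgroup.centralizer ({γ} : Set (↥(UnitaryGroup.arch (↥(maximalRealSubfield L)) L (IsCMField.complexConj L) 3 H)))) := fun _ => borel _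
    haveI : ∀ γ : ↥(UnitaryGroup.arch (↥(maximalRealSubfield L)) L (IsCMField.complexConj L) 3 H), BorelSpace (↥(UnitaryGroup.arch (↥(maximalRealSubfield L)) L (IsCMField.complexConj L) 3 H) ⧸ Subgroup.centralizer ({γ} : Set (↥(UnitaryGroup.arch (↥(maximalRealSubfield L)) L (IsCMField.complexConj L) 3 H)))) := fun _ => ⟨rfl⟩
    letI : ∀ γ : ↥(UnitaryGroup.arch (↥(maximalRealSubfield L)) L (IsCMField.complexConj L) 3 (Matrix.of fun i j : Fin 3 => if i.val + j.val + 1 = 3 then (1 : L) else 0)), MeasurableSpace (↥(UnitaryGroup.arch (↥(maximalRealSubfield L)) L (IsCMField.complexConj L) 3 (Matrix.of fun i j : Fin 3 => if i.val + j.val + 1 = 3 then (1 : L) else 0)) ⧸ Subgroup.centralizer ({γ} : Set (↥(UnitaryGroup.arch (↥(maximalRealSubfield L)) L (IsCMField.complexConj L) 3 (Matrix.of fun i j : Fin 3 => if i.val + j.val + 1 = 3 then (1 : L) else 0))))) := fun _ => borel _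
    haveI : ∀ γ : ↥(UnitaryGroup.arch (↥(maximalRealSubfield L)) L (IsCMField.complexConj L) 3 (Matrix.of fun i j : Fin 3 => if i.val + j.val + 1 = 3 then (1 : L) else 0)), BorelSpace (↥(UnitaryGroup.arch (↥(maximalRealSubfield L)) L (IsCMField.complexConj L) 3 (Matrix.of fun i j : Fin 3 => if i.val + j.val + 1 = 3 then (1 : L) else 0)) ⧸ Subgroup.centralizer ({γ} : Set (↥(UnitaryGroup.arch (↥(maximalRealSubfield L)) L (IsCMField.complexConj L) 3 (Matrix.of fun i j : Fin 3 => if i.val + j.val + 1 = 3 then (1 : L) else 0))))) := fun _ => ⟨rfl⟩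
    letI : ∀ (v : HeightOneSpectrum (𝓞 ↥(maximalRealSubfield L))) (a : ((UnitaryGroup.cmDatum L 2 (Matrix.of fun i j : Fin 2 => if i.val + j.val + 1 = 2 then (1 : L) else 0)).Local v × (UnitaryGroup.cmDatum L 1 (Matrix.of fun i j : Fin 1 => if i.val + j.val + 1 = 1 then (1 : L) else 0)).Local v)),
      MeasurableSpace (((UnitaryGroup.cmDatum L 2 (Matrix.of fun i j : Fin 2 => if i.val + j.val + 1 = 2 then (1 : L) else 0)).Local v × (UnitaryGroup.cmDatum L 1 (Matrix.of fun i j : Fin 1 => if i.val + j.val + 1 = 1 then (1 : L) else 0)).Local v) ⧸ Subgroup.centralizer ({a} : Set (((UnitaryGroup.cmDatum L 2 (Matrix.of fun i j : Fin 2 => if i.val + j.val + 1 = 2 then (1 : L) else 0)).Local v × (UnitaryGroup.cmDatum L 1 (Matrix.of fun i j : Fin 1 => if i.val + j.val + 1 = 1 then (1 : L) else 0)).Local v)))) := fun _ _ => borel _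
    haveI : ∀ (v : HeightOneSpectrum (𝓞 ↥(maximalRealSubfield L))) (a : ((UnitaryGroup.cmDatum L 2 (Matrix.of fun i j : Fin 2 => if i.val + j.val + 1 = 2 then (1 : L) else 0)).Local v × (UnitaryGroup.cmDatum L 1 (Matrix.of fun i j : Fin 1 => if i.val + j.val + 1 = 1 then (1 : L) else 0)).Local v)),
      BorelSpace (((UnitaryGroup.cmDatum L 2 (Matrix.of fun i j : Fin 2 => if i.val + j.val + 1 = 2 then (1 : L) else 0)).Local v × (UnitaryGroup.cmDatum L 1 (Matrix.of fun i j : Fin 1 => if i.val + j.val + 1 = 1 then (1 : L) else 0)).Local v) ⧸ Subgroup.centralizer ({a} : Set (((UnitaryGroup.cmDatum L 2 (Matrix.of fun i j : Fin 2 => if i.val + j.val + 1 = 2 then (1 : L) else 0)).Local v × (UnitaryGroup.cmDatum L 1 (Matrix.of fun i j : Fin 1 => if i.val + j.val + 1 = 1 then (1 : L) else 0)).Local v)))) := fun _ _ => ⟨rfl⟩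
    letI : ∀ a : (↥(UnitaryGroup.arch (↥(maximalRealSubfield L)) L (IsCMField.complexConj L) 2 (Matrix.of fun i j : Fin 2 => if i.val + j.val + 1 = 2 then (1 : L) else 0)) × ↥(UnitaryGroup.arch (↥(maximalRealSubfield L)) L (IsCMField.complexConj L) 1 (Matrix.of fun i j : Fin 1 => if i.val + j.val + 1 = 1 then (1 : L) else 0))), MeasurableSpace ((↥(UnitaryGroup.arch (↥(maximalRealSubfield L)) L (IsCMField.complexConj L) 2 (Matrix.of fun i j : Fin 2 => if i.val + j.val + 1 = 2 then (1 : L) else 0)) × ↥(UnitaryGroup.arch (↥(maximalRealSubfield L)) L (IsCMField.complexConj L) 1 (Matrix.of fun i j : Fin 1 => if i.val + j.val + 1 = 1 then (1 : L) else 0))) ⧸ Subgroup.centralizer ({a} : Set ((↥(UnitaryGroup.arch (↥(maximalRealSubfield L)) L (IsCMField.complexConj L) 2 (Matrix.of fun i j : Fin 2 => if i.val + j.val + 1 = 2 then (1 : L) else 0)) × ↥(UnitaryGroup.arch (↥(maximalRealSubfield L)) L (IsCMField.complexConj L) 1 (Matrix.of fun i j : Fin 1 => if i.val + j.val + 1 =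 1 then (1 : L) else 0)))))) := fun _ => borel _
    haveI : ∀ a : (↥(UnitaryGroup.arch (↥(maximalRealSubfield L)) L (IsCMField.complexConj L) 2 (Matrix.of fun i j : Fin 2 => if i.val + j.val + 1 = 2 then (1 : L) else 0)) × ↥(UnitaryGroup.arch (↥(maximalRealSubfield L)) L (IsCMField.complexConj L) 1 (Matrix.of fun i j : Fin 1 => if i.val + j.val + 1 = 1 then (1 : L) else 0))), BorelSpace ((↥(UnitaryGroup.arch (↥(maximalRealSubfield L)) L (IsCMField.complexConj L) 2 (Matrix.of fun i j : Fin 2 => if i.val + j.val + 1 = 2 then (1 : L) else 0)) × ↥(UnitaryGroup.arch (↥(maximalRealSubfield L)) L (IsCMField.complexConj L) 1 (Matrix.of fun i j : Fin 1 => if i.val + j.val + 1 = 1 then (1 : L) else 0))) ⧸ Subgroup.centralizer ({a} : Set ((↥(UnitaryGroup.arch (↥(maximalRealSubfield L)) L (IsCMField.complexConj L) 2 (Matrix.of fun i j : Fin 2 => if i.val + j.val + 1 = 2 then (1 : L) else 0)) × ↥(UnitaryGroup.arch (↥(maximalRealSubfield L)) L (IsCMField.complexConj L) 1 (Matrix.of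 fun i j : Fin 1 => if i.val + j.val + 1 = 1 then (1 : L) else 0)))))) := fun _ => ⟨rfl⟩
    letI : ∀ γ : (UnitaryGroup.cmDatum L 3 H).Adelic, MeasurableSpace (↥(Subgroup.centralizer ({γ} : Set ((UnitaryGroup.cmDatum L 3 H).Adelic))) ⧸
      ((UnitaryGroup.cmDatum L 3 H).quotientSubgroup ⊓ Subgroup.centralizer ({γ} : Set ((UnitaryGroup.cmDatum L 3 H).Adelic))).subgroupOf
        (Subgroup.centralizer ({γ} : Set ((UnitaryGroup.cmDatum L 3 H).Adelic)))) := fun _ => borel _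
    haveI : ∀ γ : (UnitaryGroup.cmDatum L 3 H).Adelic, BorelSpace (↥(Subgroup.centralizer ({γ} : Set ((UnitaryGroup.cmDatum L 3 H).Adelic))) ⧸
      ((UnitaryGroup.cmDatum L 3 H).quotientSubgroup ⊓ Subgroup.centralizer ({γ} : Set ((UnitaryGroup.cmDatum L 3 H).Adelic))).subgroupOf
        (Subgroup.centralizer ({γ} : Set ((UnitaryGroup.cmDatum L 3 H).Adelic)))) := fun _ => ⟨rfl⟩
    haveI hCcl : ∀ γ : (UnitaryGroup.cmDatum L 3 H).Adelic, IsClosed ((Subgroup.centralizer ({γ} : Set ((UnitaryGroup.cmDatum L 3 H).Adelic)) : Subgroup ((UnitaryGroup.cmDatum L 3 H).Adelic)) : Set ((UnitaryGroup.cmDatum L 3 H).Adelic)) :=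
      fun γ => UnitaryGroup.isClosed_centralizer_cmDatum L 3 H γ
    haveI : ∀ γ : (UnitaryGroup.cmDatum L 3 H).Adelic, (Measure.count : Measure ↥(((UnitaryGroup.cmDatum L 3 H).quotientSubgroup ⊓
      Subgroup.centralizer ({γ} : Set ((UnitaryGroup.cmDatum L 3 H).Adelic))).subgroupOf (Subgroup.centralizer ({γ} : Set ((UnitaryGroup.cmDatum L 3 H).Adelic))))).IsHaarMeasure :=
      fun γ => UnitaryGroup.isHaarMeasure_count_quotientSubgroup_inf_centralizer_subgroupOf L 3 H γ
    haveI : ν.IsMulRightInvariant := by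
      have h : ν.inv.IsMulRightInvariant := inferInstance
      rwa [Measure.inv_eq_self] at h
    Literature.NumberTheory.Rogawski1990.SingularEllipticTransferCanonicalPinned L H μω νH νG νGi νqi νHi ν) ∧
    -- `hGTQ` of `Rung0Witness` at `Tinf := Δ‴_∞`, for EVERY rider `Q` that holds at print's `Δ‴` and canonical pairs
    (letI : ∀ v : HeightOneSpectrum (𝓞 ↥(maximalRealSubfield L)), MeasurableSpace ((UnitaryGroup.cmDatum L 3 H).Local v) := fun _ => borel _
    haveI : ∀ v : HeightOneSpectrum (𝓞 ↥(maximalRealSubfield L)), BorelSpace ((UnitaryGroup.cmDatum L 3 H).Local v) := fun _ => ⟨rfl⟩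
    letI : ∀ v : HeightOneSpectrum (𝓞 ↥(maximalRealSubfield L)), MeasurableSpace (((UnitaryGroup.cmDatum L 2 (Matrix.of fun i j : Fin 2 => if i.val + j.val + 1 = 2 then (1 : L) else 0)).Local v × (UnitaryGroup.cmDatum L 1 (Matrix.of fun i j : Fin 1 => if i.val + j.val + 1 = 1 then (1 : L) else 0)).Local v)) := fun _ => borel _
    haveI : ∀ v : HeightOneSpectrum (𝓞 ↥(maximalRealSubfield L)), BorelSpace (((UnitaryGroup.cmDatum L 2 (Matrix.of fun i j : Fin 2 => if i.val + j.val + 1 = 2 then (1 : L) else 0)).Local v × (UnitaryGroup.cmDatum L 1 (Matrix.of fun i j : Fin 1 => if i.val + j.val + 1 = 1 then (1 : L) else 0)).Local v)) := fun _ => ⟨rfl⟩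
    haveI : ∀ v : HeightOneSpectrum (𝓞 ↥(maximalRealSubfield L)), (νH v).IsHaarMeasure := isHaar_νH
    haveI : ∀ v : HeightOneSpectrum (𝓞 ↥(maximalRealSubfield L)), (νH v).IsMulRightInvariant := isRightInv_νH
    haveI : ∀ v : HeightOneSpectrum (𝓞 ↥(maximalRealSubfield L)), (νG v).IsHaarMeasure := isHaar_νG
    haveI : ∀ v : HeightOneSpectrum (𝓞 ↥(maximalRealSubfield L)), (νG v).IsMulRightInvariant := isRightInv_νG
    ∀ (Q : letI : ∀ (v : HeightOneSpectrum (𝓞 ↥(maximalRealSubfield L)))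
          (a : ((UnitaryGroup.cmDatum L 2 (Matrix.of fun i j : Fin 2 => if i.val + j.val + 1 = 2 then (1 : L) else 0)).Local v ×
            (UnitaryGroup.cmDatum L 1 (Matrix.of fun i j : Fin 1 => if i.val + j.val + 1 = 1 then (1 : L) else 0)).Local v)),
          MeasurableSpace (((UnitaryGroup.cmDatum L 2 (Matrix.of fun i j : Fin 2 => if i.val + j.val + 1 = 2 then (1 : L) else 0)).Local v ×
            (UnitaryGroup.cmDatum L 1 (Matrix.of fun i j : Fin 1 => if i.val + j.val + 1 = 1 then (1 : L) else 0)).Local v) ⧸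
            Subgroup.centralizer ({a} : Set ((UnitaryGroup.cmDatum L 2 (Matrix.of fun i j : Fin 2 => if i.val + j.val + 1 = 2 then (1 : L) else 0)).Local v ×
            (UnitaryGroup.cmDatum L 1 (Matrix.of fun i j : Fin 1 => if i.val + j.val + 1 = 1 then (1 : L) else 0)).Local v))) :=
        fun _ _ => borel _
      letI : ∀ (v : HeightOneSpectrum (𝓞 ↥(maximalRealSubfield L))) (γ : (UnitaryGroup.cmDatum L 3 H).Local v),
          MeasurableSpace ((UnitaryGroup.cmDatum L 3 H).Local v ⧸ Subgroup.centralizer ({γ} : Set ((UnitaryGroup.cmDatum L 3 H).Local v))) :=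
        fun _ _ => borel _
      (∀ v : HeightOneSpectrum (𝓞 ↥(maximalRealSubfield L)), LocalTransferFactor L H v) →
      (∀ v : HeightOneSpectrum (𝓞 ↥(maximalRealSubfield L)),
        OrbitalMeasureFamily ((UnitaryGroup.cmDatum L 2 (Matrix.of fun i j : Fin 2 => if i.val + j.val + 1 = 2 then (1 : L) else 0)).Local v ×
          (UnitaryGroup.cmDatum L 1 (Matrix.of fun i j : Fin 1 => if i.val + j.val + 1 = 1 then (1 : L) else 0)).Local v)) →
      (∀ v : HeightOneSpectrum (𝓞 ↥(maximalRealSubfield L)), OrbitalMeasureFamily ((UnitaryGroup.cmDatum L 3 H).Local v)) → Prop),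
      (
      letI : ∀ (v : HeightOneSpectrum (𝓞 ↥(maximalRealSubfield L)))
          (a : ((UnitaryGroup.cmDatum L 2 (Matrix.of fun i j : Fin 2 => if i.val + j.val + 1 = 2 then (1 : L) else 0)).Local v ×
            (UnitaryGroup.cmDatum L 1 (Matrix.of fun i j : Fin 1 => if i.val + j.val + 1 = 1 then (1 : L) else 0)).Local v)),
          MeasurableSpace (((UnitaryGroup.cmDatum L 2 (Matrix.of fun i j : Fin 2 => if i.val + j.val + 1 = 2 then (1 : L) else 0)).Local v ×
            (UnitaryGroup.cmDatum L 1 (Matrix.of fun i j : Fin 1 => if i.val + j.val + 1 = 1 then (1 : L) else 0)).Local v) ⧸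
            Subgroup.centralizer ({a} : Set ((UnitaryGroup.cmDatum L 2 (Matrix.of fun i j : Fin 2 => if i.val + j.val + 1 = 2 then (1 : L) else 0)).Local v ×
            (UnitaryGroup.cmDatum L 1 (Matrix.of fun i j : Fin 1 => if i.val + j.val + 1 = 1 then (1 : L) else 0)).Local v))) :=
        fun _ _ => borel _
      haveI : ∀ (v : HeightOneSpectrum (𝓞 ↥(maximalRealSubfield L)))
          (a : ((UnitaryGroup.cmDatum L 2 (Matrix.of fun i j : Fin 2 => if i.val + j.val + 1 = 2 then (1 : L) else 0)).Local v ×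
            (UnitaryGroup.cmDatum L 1 (Matrix.of fun i j : Fin 1 => if i.val + j.val + 1 = 1 then (1 : L) else 0)).Local v)),
          BorelSpace (((UnitaryGroup.cmDatum L 2 (Matrix.of fun i j : Fin 2 => if i.val + j.val + 1 = 2 then (1 : L) else 0)).Local v ×
            (UnitaryGroup.cmDatum L 1 (Matrix.of fun i j : Fin 1 => if i.val + j.val + 1 = 1 then (1 : L) else 0)).Local v) ⧸
            Subgroup.centralizer ({a} : Set ((UnitaryGroup.cmDatum L 2 (Matrix.of fun i j : Fin 2 => if i.val + j.val + 1 = 2 then (1 : L) else 0)).Local v ×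
            (UnitaryGroup.cmDatum L 1 (Matrix.of fun i j : Fin 1 => if i.val + j.val + 1 = 1 then (1 : L) else 0)).Local v))) :=
        fun _ _ => ⟨rfl⟩
      letI : ∀ (v : HeightOneSpectrum (𝓞 ↥(maximalRealSubfield L))) (γ : (UnitaryGroup.cmDatum L 3 H).Local v),
          MeasurableSpace ((UnitaryGroup.cmDatum L 3 H).Local v ⧸ Subgroup.centralizer ({γ} : Set ((UnitaryGroup.cmDatum L 3 H).Local v))) :=
        fun _ _ => borel _
      haveI : ∀ (v : HeightOneSpectrum (𝓞 ↥(maximalRealSubfield L))) (γ : (UnitaryGroup.cmDatum L 3 H).Local v),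
          BorelSpace ((UnitaryGroup.cmDatum L 3 H).Local v ⧸ Subgroup.centralizer ({γ} : Set ((UnitaryGroup.cmDatum L 3 H).Local v))) :=
        fun _ _ => ⟨rfl⟩
      ∀ (mH : ∀ v : HeightOneSpectrum (𝓞 ↥(maximalRealSubfield L)),
          OrbitalMeasureFamily ((UnitaryGroup.cmDatum L 2 (Matrix.of fun i j : Fin 2 => if i.val + j.val + 1 = 2 then (1 : L) else 0)).Local v ×
          (UnitaryGroup.cmDatum L 1 (Matrix.of fun i j : Fin 1 => if i.val + j.val + 1 = 1 then (1 : L) else 0)).Local v))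
        (mG : ∀ v : HeightOneSpectrum (𝓞 ↥(maximalRealSubfield L)), OrbitalMeasureFamily ((UnitaryGroup.cmDatum L 3 H).Local v)),
        (∀ v : HeightOneSpectrum (𝓞 ↥(maximalRealSubfield L)),
            (mH v).IsCanonical (IsLocalGRegular L v) (νH v) ∧
              (mG v).IsCanonical (fun γ => IsRegularElt (γ.val : GL (Fin 3) (UnitaryGroup.LocalRing L v))) (νG v)) →
          Q (finExplicitCollection L H μω (finExplicitDelta_conj_left_all L H μω) (finExplicitDelta_conj_right_all L H μω)) mH mG) →
      GlobalTransferWithStabilisationPackageAnd L H (Literature.NumberTheory.Rogawski1990.archCanonicalTransferFactor L H μω).Δ νH νG Q) ∧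
    -- `hPH` of `Rung0Witness`
    (letI : MeasurableSpace (F0P3InnerFormClassificationV6.Gp L H).Adelic := borel _; IsProductHaar L H ν νGi νG) := by
  obtain ⟨ν, νH, νG, νGi, -, νHi, μZ, hν, hνi, hνH, hνHr, hνG, hνGr, hK, hKH, hνGic, hνGir, -, -, hνHic, hνHir, hμZ, hPH, hGiH, -, hHiH⟩ :=
    F0P3Rung0HaarPackage.exists_rung0HaarPackage_haar L H ι T hT hdef h2
  have hherm : (H.map (cmConjRingHom L)).transpose = H := transpose_map_cmConjRingHom_eq_of_frame L ι H T hT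
  have hanis : ∀ x : Fin 3 → L, hermForm (cmConjRingHom L) H x x = 0 → x = 0 := F0P3ClassTokensOfRecord.anisotropic_of_frame L H ι hdef h2
  -- Borel structures on every carrier (the ★ K0 ∕ `FrameData` convention of the closer)
  letI : MeasurableSpace ((UnitaryGroup.cmDatum L 3 H).Adelic) := borel _
  haveI : BorelSpace ((UnitaryGroup.cmDatum L 3 H).Adelic) := ⟨rfl⟩
  letI : ∀ v : HeightOneSpectrum (𝓞 ↥(maximalRealSubfield L)), MeasurableSpace ((UnitaryGroup.cmDatum L 3 H).Local v) := fun _ => borel _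
  haveI : ∀ v : HeightOneSpectrum (𝓞 ↥(maximalRealSubfield L)), BorelSpace ((UnitaryGroup.cmDatum L 3 H).Local v) := fun _ => ⟨rfl⟩
  letI : ∀ v : HeightOneSpectrum (𝓞 ↥(maximalRealSubfield L)), MeasurableSpace ((UnitaryGroup.cmDatum L 2 (Matrix.of fun i j : Fin 2 => if i.val + j.val + 1 = 2 then (1 : L) else 0)).Local v × (UnitaryGroup.cmDatum L 1 (Matrix.of fun i j : Fin 1 => if i.val + j.val + 1 = 1 then (1 : L) else 0)).Local v) := fun _ => borel _
  haveI : ∀ v : HeightOneSpectrum (𝓞 ↥(maximalRealSubfield L)), BorelSpace ((UnitaryGroup.cmDatum L 2 (Matrix.of fun i j : Fin 2 => if i.val + j.val + 1 = 2 then (1 : L) else 0)).Local v × (UnitaryGroup.cmDatum L 1 (Matrix.of fun i j : Fin 1 => if i.val + j.val + 1 = 1 then (1 : L) else 0)).Local v) := fun _ => ⟨rfl⟩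
  letI : MeasurableSpace ↥(UnitaryGroup.arch (↥(maximalRealSubfield L)) L (IsCMField.complexConj L) 3 H) := borel _
  haveI : BorelSpace ↥(UnitaryGroup.arch (↥(maximalRealSubfield L)) L (IsCMField.complexConj L) 3 H) := ⟨rfl⟩
  letI : MeasurableSpace ↥(UnitaryGroup.arch (↥(maximalRealSubfield L)) L (IsCMField.complexConj L) 3 (Matrix.of fun i j : Fin 3 => if i.val + j.val + 1 = 3 then (1 : L) else 0)) := borel _
  haveI : BorelSpace ↥(UnitaryGroup.arch (↥(maximalRealSubfield L)) L (IsCMField.complexConj L) 3 (Matrix.of fun i j : Fin 3 => if i.val + j.val + 1 = 3 then (1 : L) else 0)) := ⟨rfl⟩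
  letI : MeasurableSpace (↥(UnitaryGroup.arch (↥(maximalRealSubfield L)) L (IsCMField.complexConj L) 2 (Matrix.of fun i j : Fin 2 => if i.val + j.val + 1 = 2 then (1 : L) else 0)) × ↥(UnitaryGroup.arch (↥(maximalRealSubfield L)) L (IsCMField.complexConj L) 1 (Matrix.of fun i j : Fin 1 => if i.val + j.val + 1 = 1 then (1 : L) else 0))) := borel _
  haveI : BorelSpace (↥(UnitaryGroup.arch (↥(maximalRealSubfield L)) L (IsCMField.complexConj L) 2 (Matrix.of fun i j : Fin 2 => if i.val + j.val + 1 = 2 then (1 : L) else 0)) × ↥(UnitaryGroup.arch (↥(maximalRealSubfield L)) L (IsCMField.complexConj L) 1 (Matrix.of fun i j : Fin 1 => if i.val + j.val + 1 = 1 then (1 : L) else 0))) := ⟨rfl⟩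
  -- the package's measure facts as instances
  haveI : ν.IsHaarMeasure := hν
  haveI : ν.IsInvInvariant := hνi
  haveI : ∀ v : HeightOneSpectrum (𝓞 ↥(maximalRealSubfield L)), (νH v).IsHaarMeasure := hνH
  haveI : ∀ v : HeightOneSpectrum (𝓞 ↥(maximalRealSubfield L)), (νH v).IsMulRightInvariant := hνHr
  haveI : ∀ v : HeightOneSpectrum (𝓞 ↥(maximalRealSubfield L)), (νG v).IsHaarMeasure := hνG
  haveI : ∀ v : HeightOneSpectrum (𝓞 ↥(maximalRealSubfield L)), (νG v).IsMulRightInvariant := hνGr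
  haveI : IsFiniteMeasureOnCompacts νGi := hνGic
  haveI : νGi.IsMulRightInvariant := hνGir
  haveI : νGi.IsHaarMeasure := hGiH
  haveI : IsFiniteMeasureOnCompacts νHi := hνHic
  haveI : νHi.IsMulRightInvariant := hνHir
  haveI : νHi.IsHaarMeasure := hHiH
  -- `νqi` on the print-compatible ray, FROM the (S-d) letter
  obtain ⟨νqi, hqiH, hqiR, hSd'⟩ := hSd L H (Literature.NumberTheory.Rogawski1990.archCanonicalTransferFactor L H μω) νGi νHi
  haveI : νqi.IsHaarMeasure := hqiH
  haveI : νqi.IsMulRightInvariant := hqiR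
  haveI hqic : IsFiniteMeasureOnCompacts νqi := inferInstance
  -- orbit-quotient structures of the singular package (MAIN-b's `hSET` preamble, as the closer states it)
  letI : ∀ (v : HeightOneSpectrum (𝓞 ↥(maximalRealSubfield L))) (γ : (UnitaryGroup.cmDatum L 3 H).Local v),
    MeasurableSpace ((UnitaryGroup.cmDatum L 3 H).Local v ⧸
      Subgroup.centralizer ({γ} : Set ((UnitaryGroup.cmDatum L 3 H).Local v))) := fun _ _ => borel _
  haveI : ∀ (v : HeightOneSpectrum (𝓞 ↥(maximalRealSubfield L))) (γ : (UnitaryGroup.cmDatum L 3 H).Local v),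
    BorelSpace ((UnitaryGroup.cmDatum L 3 H).Local v ⧸
      Subgroup.centralizer ({γ} : Set ((UnitaryGroup.cmDatum L 3 H).Local v))) := fun _ _ => ⟨rfl⟩
  letI : ∀ g : (UnitaryGroup.cmDatum L 3 H).Adelic, MeasurableSpace ((UnitaryGroup.cmDatum L 3 H).Adelic ⧸ Subgroup.centralizer ({g} : Set ((UnitaryGroup.cmDatum L 3 H).Adelic))) := fun _ => borel _
  haveI : ∀ g : (UnitaryGroup.cmDatum L 3 H).Adelic, BorelSpace ((UnitaryGroup.cmDatum L 3 H).Adelic ⧸ Subgroup.centralizer ({g} : Set ((UnitaryGroup.cmDatum L 3 H).Adelic))) := fun _ => ⟨rfl⟩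
  letI : ∀ γ : ↥(UnitaryGroup.arch (↥(maximalRealSubfield L)) L (IsCMField.complexConj L) 3 H), MeasurableSpace (↥(UnitaryGroup.arch (↥(maximalRealSubfield L)) L (IsCMField.complexConj L) 3 H) ⧸ Subgroup.centralizer ({γ} : Set (↥(UnitaryGroup.arch (↥(maximalRealSubfield L)) L (IsCMField.complexConj L) 3 H)))) := fun _ => borel _
  haveI : ∀ γ : ↥(UnitaryGroup.arch (↥(maximalRealSubfield L)) L (IsCMField.complexConj L) 3 H), BorelSpace (↥(UnitaryGroup.arch (↥(maximalRealSubfield L)) L (IsCMField.complexConj L) 3 H) ⧸ Subgroup.centralizer ({γ} : Set (↥(UnitaryGroup.arch (↥(maximalRealSubfield L)) L (IsCMField.complexConj L) 3 H)))) := fun _ => ⟨rfl⟩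
  letI : ∀ γ : ↥(UnitaryGroup.arch (↥(maximalRealSubfield L)) L (IsCMField.complexConj L) 3 (Matrix.of fun i j : Fin 3 => if i.val + j.val + 1 = 3 then (1 : L) else 0)), MeasurableSpace (↥(UnitaryGroup.arch (↥(maximalRealSubfield L)) L (IsCMField.complexConj L) 3 (Matrix.of fun i j : Fin 3 => if i.val + j.val + 1 = 3 then (1 : L) else 0)) ⧸ Subgroup.centralizer ({γ} : Set (↥(UnitaryGroup.arch (↥(maximalRealSubfield L)) L (IsCMField.complexConj L) 3 (Matrix.of fun i j : Fin 3 => if i.val + j.val + 1 = 3 then (1 : L) else 0))))) := fun _ => borel _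
  haveI : ∀ γ : ↥(UnitaryGroup.arch (↥(maximalRealSubfield L)) L (IsCMField.complexConj L) 3 (Matrix.of fun i j : Fin 3 => if i.val + j.val + 1 = 3 then (1 : L) else 0)), BorelSpace (↥(UnitaryGroup.arch (↥(maximalRealSubfield L)) L (IsCMField.complexConj L) 3 (Matrix.of fun i j : Fin 3 => if i.val + j.val + 1 = 3 then (1 : L) else 0)) ⧸ Subgroup.centralizer ({γ} : Set (↥(UnitaryGroup.arch (↥(maximalRealSubfield L)) L (IsCMField.complexConj L) 3 (Matrix.of fun i j : Fin 3 => if i.val + j.val + 1 = 3 then (1 : L) else 0))))) := fun _ => ⟨rfl⟩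
  letI : ∀ (v : HeightOneSpectrum (𝓞 ↥(maximalRealSubfield L))) (a : ((UnitaryGroup.cmDatum L 2 (Matrix.of fun i j : Fin 2 => if i.val + j.val + 1 = 2 then (1 : L) else 0)).Local v × (UnitaryGroup.cmDatum L 1 (Matrix.of fun i j : Fin 1 => if i.val + j.val + 1 = 1 then (1 : L) else 0)).Local v)),
    MeasurableSpace (((UnitaryGroup.cmDatum L 2 (Matrix.of fun i j : Fin 2 => if i.val + j.val + 1 = 2 then (1 : L) else 0)).Local v × (UnitaryGroup.cmDatum L 1 (Matrix.of fun i j : Fin 1 => if i.val + j.val + 1 = 1 then (1 : L) else 0)).Local v) ⧸ Subgroup.centralizer ({a} : Set (((UnitaryGroup.cmDatum L 2 (Matrix.of fun i j : Fin 2 => if i.val + j.val + 1 = 2 then (1 : L) else 0)).Local v × (UnitaryGroup.cmDatum L 1 (Matrix.of fun i j : Fin 1 => if i.val + j.val + 1 = 1 then (1 : L) else 0)).Local v)))) := fun _ _ => borel _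
  haveI : ∀ (v : HeightOneSpectrum (𝓞 ↥(maximalRealSubfield L))) (a : ((UnitaryGroup.cmDatum L 2 (Matrix.of fun i j : Fin 2 => if i.val + j.val + 1 = 2 then (1 : L) else 0)).Local v × (UnitaryGroup.cmDatum L 1 (Matrix.of fun i j : Fin 1 => if i.val + j.val + 1 = 1 then (1 : L) else 0)).Local v)),
    BorelSpace (((UnitaryGroup.cmDatum L 2 (Matrix.of fun i j : Fin 2 => if i.val + j.val + 1 = 2 then (1 : L) else 0)).Local v × (UnitaryGroup.cmDatum L 1 (Matrix.of fun i j : Fin 1 => if i.val + j.val + 1 = 1 then (1 : L) else 0)).Local v) ⧸ Subgroup.centralizer ({a} : Set (((UnitaryGroup.cmDatum L 2 (Matrix.of fun i j : Fin 2 => if i.val + j.val + 1 = 2 then (1 : L) else 0)).Local v × (UnitaryGroup.cmDatum L 1 (Matrix.of fun i j : Fin 1 => if i.val + j.val + 1 = 1 then (1 : L) else 0)).Local v)))) := fun _ _ => ⟨rfl⟩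
  letI : ∀ a : (↥(UnitaryGroup.arch (↥(maximalRealSubfield L)) L (IsCMField.complexConj L) 2 (Matrix.of fun i j : Fin 2 => if i.val + j.val + 1 = 2 then (1 : L) else 0)) × ↥(UnitaryGroup.arch (↥(maximalRealSubfield L)) L (IsCMField.complexConj L) 1 (Matrix.of fun i j : Fin 1 => if i.val + j.val + 1 = 1 then (1 : L) else 0))), MeasurableSpace ((↥(UnitaryGroup.arch (↥(maximalRealSubfield L)) L (IsCMField.complexConj L) 2 (Matrix.of fun i j : Fin 2 => if i.val + j.val + 1 = 2 then (1 : L) else 0)) × ↥(UnitaryGroup.arch (↥(maximalRealSubfield L)) L (IsCMField.complexConj L) 1 (Matrix.of fun i j : Fin 1 => if i.val + j.val + 1 = 1 then (1 : L) else 0))) ⧸ Subgroup.centralizer ({a} : Set ((↥(UnitaryGroup.arch (↥(maximalRealSubfield L)) L (IsCMField.complexConj L) 2 (Matrix.of fun i j : Fin 2 => if i.val + j.val + 1 = 2 then (1 : L) else 0)) × ↥(UnitaryGroup.arch (↥(maximalRealSubfield L)) L (IsCMField.complexConj L) 1 (Matrix.of fun i j : Fin 1 => if i.val + j.val + 1 =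 1 then (1 : L) else 0)))))) := fun _ => borel _
  haveI : ∀ a : (↥(UnitaryGroup.arch (↥(maximalRealSubfield L)) L (IsCMField.complexConj L) 2 (Matrix.of fun i j : Fin 2 => if i.val + j.val + 1 = 2 then (1 : L) else 0)) × ↥(UnitaryGroup.arch (↥(maximalRealSubfield L)) L (IsCMField.complexConj L) 1 (Matrix.of fun i j : Fin 1 => if i.val + j.val + 1 = 1 then (1 : L) else 0))), BorelSpace ((↥(UnitaryGroup.arch (↥(maximalRealSubfield L)) L (IsCMField.complexConj L) 2 (Matrix.of fun i j : Fin 2 => if i.val + j.val + 1 = 2 then (1 : L) else 0)) × ↥(UnitaryGroup.arch (↥(maximalRealSubfield L)) L (IsCMField.complexConj L) 1 (Matrix.of fun i j : Fin 1 => if i.val + j.val + 1 = 1 then (1 : L) else 0))) ⧸ Subgroup.centralizer ({a} : Set ((↥(UnitaryGroup.arch (↥(maximalRealSubfield L)) L (IsCMField.complexConj L) 2 (Matrix.of fun i j : Fin 2 => if i.val + j.val + 1 = 2 then (1 : L) else 0)) × ↥(UnitaryGroup.arch (↥(maximalRealSubfield L)) L (IsCMField.complexConj L) 1 (Matrix.of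 fun i j : Fin 1 => if i.val + j.val + 1 = 1 then (1 : L) else 0)))))) := fun _ => ⟨rfl⟩
  letI : ∀ γ : (UnitaryGroup.cmDatum L 3 H).Adelic, MeasurableSpace (↥(Subgroup.centralizer ({γ} : Set ((UnitaryGroup.cmDatum L 3 H).Adelic))) ⧸
    ((UnitaryGroup.cmDatum L 3 H).quotientSubgroup ⊓ Subgroup.centralizer ({γ} : Set ((UnitaryGroup.cmDatum L 3 H).Adelic))).subgroupOf
      (Subgroup.centralizer ({γ} : Set ((UnitaryGroup.cmDatum L 3 H).Adelic)))) := fun _ => borel _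
  haveI : ∀ γ : (UnitaryGroup.cmDatum L 3 H).Adelic, BorelSpace (↥(Subgroup.centralizer ({γ} : Set ((UnitaryGroup.cmDatum L 3 H).Adelic))) ⧸
    ((UnitaryGroup.cmDatum L 3 H).quotientSubgroup ⊓ Subgroup.centralizer ({γ} : Set ((UnitaryGroup.cmDatum L 3 H).Adelic))).subgroupOf
      (Subgroup.centralizer ({γ} : Set ((UnitaryGroup.cmDatum L 3 H).Adelic)))) := fun _ => ⟨rfl⟩
  haveI hCcl : ∀ γ : (UnitaryGroup.cmDatum L 3 H).Adelic, IsClosed ((Subgroup.centralizer ({γ} : Set ((UnitaryGroup.cmDatum L 3 H).Adelic)) : Subgroup ((UnitaryGroup.cmDatum L 3 H).Adelic)) : Set ((UnitaryGroup.cmDatum L 3 H).Adelic)) :=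
    fun γ => UnitaryGroup.isClosed_centralizer_cmDatum L 3 H γ
  haveI : ∀ γ : (UnitaryGroup.cmDatum L 3 H).Adelic, (Measure.count : Measure ↥(((UnitaryGroup.cmDatum L 3 H).quotientSubgroup ⊓
    Subgroup.centralizer ({γ} : Set ((UnitaryGroup.cmDatum L 3 H).Adelic))).subgroupOf (Subgroup.centralizer ({γ} : Set ((UnitaryGroup.cmDatum L 3 H).Adelic))))).IsHaarMeasure :=
    fun γ => UnitaryGroup.isHaarMeasure_count_quotientSubgroup_inf_centralizer_subgroupOf L 3 H γ
  haveI : ν.IsMulRightInvariant :=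
    cast (congrArg (fun m : Measure ((UnitaryGroup.cmDatum L 3 H).Adelic) => m.IsMulRightInvariant) (Measure.inv_eq_self ν)) (inferInstance : ν.inv.IsMulRightInvariant)
  refine ⟨ν, νH, νG, νGi, νqi, νHi, μZ, hν, hνi, hνH, hνHr, hνG, hνGr, hK, hKH, hνGic, hνGir, hqic, hqiR, hνHic, hνHir, hμZ, ?_, ?_, ?_, hPH⟩
  · -- `hAT₄`: (S-c) over #77 (T6-L1's composition: (M) ★, N2∞ ★, N8, N9″ moved to `Δ‴_∞` along the ray), the compact place ★, and (S-d) at the compatible `νqi`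
    exact hSc L H (Literature.NumberTheory.Rogawski1990.archCanonicalTransferFactor L H μω) νGi νqi νHi μω hμu hμω
      ((archGlobalSign L H : ℤ) : ℂ) (archGlobalSign_cast_ne_zero L H) (archCanonicalTransferFactor_Δ L H μω)
      (fun hh ha => Literature.NumberTheory.QuadraticForms.hermitianMatrix_exists_definite_infinitePlace_of_anisotropic L H
        (by rw [Matrix.transpose_map]; exact hh) ha (Fintype.card_fin 3).ge)
      hSd'
      (F0P3aArchTransfersCanonicalOfStubs.archTransfersExistCanonical_of_stubs
        (fun _ ha => Literature.NumberTheory.Rogawski1990.exists_archCompatibleFamilies L H νGi νqi νHi ha)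
        (fun hh ha => isArchNondegenerate_archCanonicalTransferFactor L H μω hh ha)
        (h8 νGi νqi)
        (F0P3aArchTransfersCanonicalOfStubs.archEndoscopicTransferCompatible_of_ray (archCanonicalTransferFactor_Δ_eq_mul_explicit L H μω) (h9 νGi νqi νHi)))
  · -- `hSET` PINNED (#175-R): T6-L5's composition from the PINNED S1′ letter (L2), `Δ := (Δ‴_v)_v` a TERM, `Tinf := Δ‴_∞` — `Δ` is no longer introduced
    intro hanis' Sbad mH mG hCTM m' m mHi t' t tH hACS
    exact F0P3aSingularEllipticTransferOfStubs.singularEllipticTransferCanonical_of_stubs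
      (hS1 := hS1 L H μω hμu hμω νH νG νGi νqi νHi ν hK
        hanis' Sbad mH mG m' m mHi t' t tH hherm hCTM hACS)
      (hanis := hanis') (hherm := hherm) (hCTM := hCTM) (hSd := hACS.central_value)
  · -- `hGTQ Q`: T6-L4's composition over T6-L3's pointed export (N6, N7 the letters; N2f N3 N4 N5 ★)
    intro Q hQ
    exact F0P3aGlobalTransferPackageAndOfStubs.globalTransferPackageAnd_of_stubs L H μω νH νG Q hherm
      (F0P3aGlobalTransferCartanKappaOfStubs.globalTransferCartanKappa_pointed_of_stubs L H μω νH νG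
        (h6 L H μω νH νG hμu hμω hherm hanis) (h7 L H μω νH νG hμu hμω hherm hanis)
        (fun v => isLocalNondegenerate_finExplicitCollection L H μω (finExplicitDelta_conj_left_all L H μω) (finExplicitDelta_conj_right_all L H μω) v)
        (isAlmostEverywhereTrivial_finExplicitCollection_canonical L H hherm (isUnit_iff_ne_zero.mpr (Godement.det_ne_zero_of_anisotropic L H hanis)) μω)
        (satisfiesProductFormula_finExplicitCollection L H μω hherm hanis (finExplicitDelta_conj_left_all L H μω) (finExplicitDelta_conj_right_all L H μω))
        (globalKappaFormula_finExplicitCollection L H μω (finExplicitDelta_conj_left_all L H μω) (finExplicitDelta_conj_right_all L H μω)))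
      hQ

end Summit.HodgeConjecture.HodgeConjecture.Cruxes.H413.F0P3Rung0OfLettersNormalisedPinned

end
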